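import Mathlib
import Summits.AtomisticToContinuum.HydrodynamicLimit.Theorems.ImplosionDichotomyDenseExcursionPackingAnalyticDefsB

/-!
# The singular max principle: an a-priori bound for `x p′ + a(x) p = g` with VARIABLE `a(x) ≥ a₀ > 0`
# (crux `DenseExcursion`, stmt-AtomisticToContinuum-12586, line `sonic-cavity-renewal` v7, stub `stub_analyticPackingImplosion`)

Helper file (`--supports stmt-AtomisticToContinuum-12586`, line lead a2, wave-3 worker D, task (4) `sonicWindow_analytic_bound`,
fourth brick). On the sonic window the SINGULAR characteristic of the order-`k` problem reads, after division by
`−κ(1 + xα(x))`, `x p′ + a_k(x) p = g` with `a_k(x) = (kμ − c₁₁(x))/(κ(1 + xα(x))) ≥ a₀ ∼ k > 0` — a VARIABLE coefficient whose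
variation `x ã_k(x)` is itself of size `k`, so it cannot be treated as a perturbation of the constant-coefficient `T_ν` lemma
(`eulerResolvent_smooth_bound`) on a `k`-independent window. Kernel-checked here, the a-priori `C⁰` bound for a GIVEN
differentiable solution, with the full gain `1/a₀`:

* `eulerVariable_apriori_bound` (REGISTERED helper): on `[0, b]`, `a ≥ a₀ > 0`, `|g| ≤ M` ⇒ `|p| ≤ M/a₀` — fencing of `p²` by
  the constants `(M/a₀ + ε)²` (at a touching point `x > 0`: `(p²)′ = 2p(g − ap)/x < 0`; at `x = 0` the equation gives
  `|p(0)| = |g(0)|/a(0) ≤ M/a₀`, no touching), then `ε → 0`;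
* `eulerVariable_apriori_bound_neg`: the mirror statement on `[−b, 0]` (`x ↦ −x` preserves `x d/dx`).

Derivative bounds follow by differentiating the equation (`x p″ + (a + 1)p′ = g′ − a′p`: same shape, `a₀ ↦ a₀ + 1`).
Elementary over Mathlib (`image_le_of_deriv_right_lt_deriv_boundary'`). NOT here: the window estimate itself or `Γ`.
-/

noncomputable section

open Set Filter
open scoped Topology

namespace Summit.AtomisticToContinuum.HydrodynamicLimit.Theorems.PackingAnalyticImplosion

/-- **THE SINGULAR MAX PRINCIPLE** (registered helper `eulerVariable_apriori_bound` of `stub_analyticPackingImplosion`):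
a differentiable solution of `x p′ + a(x) p = g` on `[0, b]` with `a ≥ a₀ > 0` and `|g| ≤ M` there satisfies `|p| ≤ M/a₀`
on `[0, b]`. [folklore] -/
theorem eulerVariable_apriori_bound : ∀ (a g p : ℝ → ℝ) (b a₀ M : ℝ), 0 ≤ b → 0 < a₀ → (∀ x ∈ Set.Icc 0 b, a₀ ≤ a x) → (∀ x ∈ Set.Icc 0 b, |g x| ≤ M) → (∀ x ∈ Set.Icc 0 b, DifferentiableAt ℝ p x) → (∀ x ∈ Set.Icc 0 b, x * deriv p x + a x * p x = g x) → ∀ x ∈ Set.Icc 0 b, |p x| ≤ M / a₀ := by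
  intro a g p b a₀ M hb ha₀ ha hg hp heq x hx
  have h0 : (0:ℝ) ∈ Icc 0 b := left_mem_Icc.2 hb
  have hM : 0 ≤ M := (abs_nonneg _).trans (hg 0 h0)
  have hc0 : 0 ≤ M / a₀ := div_nonneg hM ha₀.le
  have hpc : ContinuousOn p (Icc 0 b) := fun y hy => (hp y hy).continuousAt.continuousWithinAt
  -- the value at `0`: `a(0) p(0) = g(0)`
  have hp0 : |p 0| ≤ M / a₀ := by
    have e := heq 0 h0
    rw [zero_mul, zero_add] at e
    have ha0 := ha 0 h0
    have hapos : 0 < a 0 := lt_of_lt_of_le ha₀ ha0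
    rw [le_div_iff₀ ha₀]
    calc |p 0| * a₀ ≤ |p 0| * a 0 := mul_le_mul_of_nonneg_left ha0 (abs_nonneg _)
      _ = |g 0| := by rw [← e, abs_mul, abs_of_pos hapos, mul_comm]
      _ ≤ M := hg 0 h0
  -- fencing of `p²` by the constant `(M/a₀ + ε)²`
  have key : ∀ ε : ℝ, 0 < ε → p x ^ 2 ≤ (M / a₀ + ε) ^ 2 := by
    intro ε hε
    have hcomp := image_le_of_deriv_right_lt_deriv_boundary' (f := fun y => p y ^ 2)
      (f' := fun y => 2 * p y * deriv p y) (a := 0) (b := b) (hpc.pow 2)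
      (fun y hy => by
        have h := ((hp y (Ico_subset_Icc_self hy)).hasDerivAt.pow 2).hasDerivWithinAt (s := Ici y)
        exact h.congr_deriv (by norm_num))
      (B := fun _ => (M / a₀ + ε) ^ 2) (B' := fun _ => 0)
      (by
        show p 0 ^ 2 ≤ (M / a₀ + ε) ^ 2
        have h1 : |p 0| ≤ M / a₀ + ε := by linarith
        nlinarith [abs_nonneg (p 0), sq_abs (p 0)])
      continuousOn_const (fun y _ => (hasDerivAt_const y _).hasDerivWithinAt)
      (fun y hy hyeq => by
        -- touching point: `|p y| = M/a₀ + ε > M/a₀ ≥ |p 0|`, so `y > 0`, and `(p²)′ = 2p(g − ap)/y < 0`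
        have habs : |p y| = M / a₀ + ε := by
          have h2 : |p y| ^ 2 = (M / a₀ + ε) ^ 2 := by rw [sq_abs]; exact hyeq
          nlinarith [abs_nonneg (p y), sq_nonneg (|p y| - (M / a₀ + ε)), sq_nonneg (|p y| + (M / a₀ + ε))]
        have hy0 : 0 < y := by
          rcases eq_or_lt_of_le hy.1 with h | h
          · exfalso; rw [← h] at habs; linarith
          · exact h
        have hyI : y ∈ Icc 0 b := Ico_subset_Icc_self hy
        have e := heq y hyI
        have hd : deriv p y = (g y - a y * p y) / y := by
          rw [eq_div_iff hy0.ne']; linarith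
        show 2 * p y * deriv p y < 0
        rw [hd]
        have hpg : p y * g y ≤ |p y| * M := by
          calc p y * g y ≤ |p y * g y| := le_abs_self _
            _ = |p y| * |g y| := abs_mul _ _
            _ ≤ |p y| * M := mul_le_mul_of_nonneg_left (hg y hyI) (abs_nonneg _)
        have hay := ha y hyI
        have hneg : p y * (g y - a y * p y) < 0 := by
          have h3 : p y ^ 2 = |p y| ^ 2 := (sq_abs _).symm
          have h4 : p y * (g y - a y * p y) ≤ |p y| * M - a₀ * |p y| ^ 2 := by
            have h5 := mul_le_mul_of_nonneg_left hay (sq_nonneg (p y))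
            rw [h3] at h5
            nlinarith [hpg, h5, h3]
          have h6 : |p y| * M - a₀ * |p y| ^ 2 = |p y| * (-(a₀ * ε)) := by
            rw [habs]; field_simp; ring
          have h7 : 0 < |p y| := by rw [habs]; positivity
          have h8 : |p y| * (-(a₀ * ε)) < 0 := mul_neg_of_pos_of_neg h7 (by nlinarith)
          linarith
        have : 2 * p y * ((g y - a y * p y) / y) = 2 / y * (p y * (g y - a y * p y)) := by
          field_simp
        rw [this]
        exact mul_neg_of_pos_of_neg (by positivity) hneg)
    exact hcomp hx
  -- `ε → 0`
  have hlim : p x ^ 2 ≤ (M / a₀) ^ 2 := by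
    have ht : Tendsto (fun ε : ℝ => (M / a₀ + ε) ^ 2) (𝓝[>] 0) (𝓝 ((M / a₀ + 0) ^ 2)) :=
      ((tendsto_const_nhds.add tendsto_id).pow 2).mono_left nhdsWithin_le_nhds
    rw [add_zero] at ht
    exact ge_of_tendsto ht (eventually_nhdsWithin_of_forall fun ε hε => key ε hε)
  have : |p x| ^ 2 ≤ (M / a₀) ^ 2 := by rw [sq_abs]; exact hlim
  nlinarith [abs_nonneg (p x), sq_nonneg (|p x| - M / a₀), sq_abs (p x)]

/-- The mirror statement on `[−b, 0]`: `x ↦ −x` preserves the Euler operator `x d/dx`. [folklore] -/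
theorem eulerVariable_apriori_bound_neg {a g p : ℝ → ℝ} {b a₀ M : ℝ} (hb : 0 ≤ b) (ha₀ : 0 < a₀)
    (ha : ∀ x ∈ Icc (-b) 0, a₀ ≤ a x) (hg : ∀ x ∈ Icc (-b) 0, |g x| ≤ M) (hp : ∀ x ∈ Icc (-b) 0, DifferentiableAt ℝ p x)
    (heq : ∀ x ∈ Icc (-b) 0, x * deriv p x + a x * p x = g x) : ∀ x ∈ Icc (-b) 0, |p x| ≤ M / a₀ := by
  intro x hx
  have hsub : ∀ y ∈ Icc 0 b, -y ∈ Icc (-b) 0 := fun y hy => ⟨by linarith [hy.2], by linarith [hy.1]⟩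
  have h := eulerVariable_apriori_bound (fun y => a (-y)) (fun y => g (-y)) (fun y => p (-y)) b a₀ M hb ha₀
    (fun y hy => ha _ (hsub y hy)) (fun y hy => hg _ (hsub y hy))
    (fun y hy => (hp _ (hsub y hy)).comp y differentiableAt_id.neg)
    (fun y hy => by
      show y * deriv (fun y => p (-y)) y + a (-y) * p (-y) = g (-y)
      rw [deriv_comp_neg p y]
      have := heq (-y) (hsub y hy)
      linarith)
    (-x) ⟨by linarith [hx.2], by linarith [hx.1]⟩
  simpa using h

end Summit.AtomisticToContinuum.HydrodynamicLimit.Theorems.PackingAnalyticImplosion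

end
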